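import Summits.AtomisticToContinuum.Crystallization.Theorems.PricedLinkCensusTruncatedCensusGapLandscapeCertDefs

/-!
# Landscape certificates for the near/far split of `TruncatedCensusGap` — kernel runs H3 (`F_hcp` floor, part 3/4)

Route `PricedLinkCensus`, crux `TruncatedCensusGap` (stmt-AtomisticToContinuum-14230), line `near-far-split`
(reshape r2 of lead c5): the landscape package N1c on the class sums `F_fcc`, `F_hcp` of `V_χ` (see
`…LandscapeCertDefs`).  This file: kernel runs of the `F_hcp` floor (C3) on leaves of a quadtree of the window (part 3 of 4; the leaves are glued in `…LandscapePackage`).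
-/

noncomputable section

namespace Summit.AtomisticToContinuum.Crystallization.Theorems.PricedLinkCensusTruncatedCensusGap.StrainedMargin

/-! ## Kernel runs: the `F_hcp` floor (C3), part 3 -/

set_option maxHeartbeats 0 in -- kernel evaluation of a box certificate (no proof search; bounded by the box count)
/-- Kernel run: `HCP` floor (`lam = 5`, `ε = 10⁻⁶`) on the sub-box `[19053 / 20000, 306603 / 320000] × [6617 / 10000, 3329 / 5000]`
(449 boxes). [folklore] -/
theorem floorH_b9 : checkFloor 5 (1 / 1000000) HCP 7 (19053 / 20000) (306603 / 320000) (6617 / 10000) (3329 / 5000) = true := by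
  decide +kernel

set_option maxHeartbeats 0 in -- kernel evaluation of a box certificate (no proof search; bounded by the box count)
/-- Kernel run: `HCP` floor (`lam = 5`, `ε = 10⁻⁶`) on the sub-box `[306603 / 320000, 154179 / 160000] × [411 / 625, 6617 / 10000]`
(41 boxes). [folklore] -/
theorem floorH_b10 : checkFloor 5 (1 / 1000000) HCP 5 (306603 / 320000) (154179 / 160000) (411 / 625) (6617 / 10000) = true := by
  decide +kernel

set_option maxHeartbeats 0 in -- kernel evaluation of a box certificate (no proof search; bounded by the box count)
/-- Kernel run: `HCP` floor (`lam = 5`, `ε = 10⁻⁶`) on the sub-box `[306603 / 320000, 154179 / 160000] × [6617 / 10000, 3329 / 5000]`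
(37 boxes). [folklore] -/
theorem floorH_b11 : checkFloor 5 (1 / 1000000) HCP 5 (306603 / 320000) (154179 / 160000) (6617 / 10000) (3329 / 5000) = true := by
  decide +kernel

set_option maxHeartbeats 0 in -- kernel evaluation of a box certificate (no proof search; bounded by the box count)
/-- Kernel run: `HCP` floor (`lam = 5`, `ε = 10⁻⁶`) on the sub-box `[19053 / 20000, 154179 / 160000] × [3329 / 5000, 337 / 500]`
(461 boxes). [folklore] -/
theorem floorH_b12 : checkFloor 5 (1 / 1000000) HCP 8 (19053 / 20000) (154179 / 160000) (3329 / 5000) (337 / 500) = true := by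
  decide +kernel


end Summit.AtomisticToContinuum.Crystallization.Theorems.PricedLinkCensusTruncatedCensusGap.StrainedMargin
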